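import Mathlib.Algebra.MvPolynomial.NoZeroDivisors
import Mathlib.LinearAlgebra.Matrix.Permanent
import Mathlib.Data.Fintype.Perm
import Literature.Computability.AlgebraicComplexity.StandardFamilies
import HarnessLib

/-!
# Rigidity of weighted permanents (one-sided Marcus–May)

Topic `Literature/Computability/AlgebraicComplexity`.  A "weighted permanent" of the generic
`N × N` matrix `x` is `∑_{σ ∈ 𝔖_N} w(σ) ∏ₜ Lₜ(x_{σ t, •})` with scalar path weights `w(σ)` and one
linear form `Lₜ = ∑_c α t c · x_{•, c}` per level `t` (this is the determinant of a GRADED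
generalised Grenet matrix with proportional levels, cf. `GrenetWeightedPaths.lean`).  We prove:

* `exists_single_of_linearForm_dvd_monomial` — a linear form dividing a monomial is a multiple of
  ONE variable (`MvPolynomial.dvd_monomial_iff_exists`);
* `exists_monomial_of_weighted_permanent_eq_perPoly` — **rigidity**: if the weighted permanent
  EQUALS `per_N(x)` as a polynomial (over a field of characteristic `0`), then `α` is a monomial
  matrix, `α t c = d t · [c = π t]` for a permutation `π` and nonzero scalars `d`, and ALL path
  weights are equal, `w(σ) · ∏ₜ d t = 1`.  Proof: substituting `x_{k,c} ↦ v_c` (all rows equal)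
  gives `(∑_σ w σ) · ∏ₜ Lₜ(v) = N! · ∏_c v_c`, so every `Lₜ` divides a monomial and is a multiple of
  a single variable `v_{π t}`; comparing exponent vectors, `π` is a bijection; finally evaluating
  the identity at the permutation matrix of `σ₀ π⁻¹` isolates `w(σ₀) ∏ d = per(P_{σ₀π⁻¹}) = 1`.

This is the one-sided, polynomial-identity form of the Marcus–May / Botta theorem (linear maps
`x ↦ x · b` preserving the permanent are monomial), which we do not need in its general form.

## Sources

* M. Marcus, F. C. May, *The permanent function*, Canad. J. Math. 14 (1962) 177–189 (linear
  preservers of the permanent; here only the elementary one-sided case, proved from scratch —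
  tagged folklore).
* J. M. Landsberg, N. Ressayre, *Permanent v. determinant: an exponential lower bound assuming
  symmetry*, Differential Geom. Appl. 55 (2017), §2.1 (`G_{perm_m}`: monomial matrices), §6
  (key `LandsbergRessayre2017`).
-/

noncomputable section

open MvPolynomial Finset

namespace Literature.Computability.AlgebraicComplexity

section LinearForm

variable {K : Type*} [CommRing K] [NoZeroDivisors K] {ι : Type*} [Fintype ι] [DecidableEq ι]

omit [NoZeroDivisors K] in
/-- The coefficient of the variable `X c` in the linear form `∑_c α c • X c` is `α c`. [folklore] -/
theorem coeff_single_linearForm (α : ι → K) (c : ι) :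
    coeff (Finsupp.single c 1) (∑ c', α c' • (X c' : MvPolynomial ι K)) = α c := by
  simp only [coeff_sum, coeff_smul, coeff_X, smul_eq_mul, Finsupp.single_left_inj one_ne_zero,
    mul_ite, mul_one, mul_zero, Finset.sum_ite_eq', mem_univ, if_true]

/-- **A linear form dividing a monomial is a multiple of one variable**: if `∑_c α c • X c` divides
`monomial s a` with `a ≠ 0` (over a domain), then exactly one coefficient `α c₀` is nonzero
(`MvPolynomial.dvd_monomial_iff_exists`: divisors of monomials are monomials, and a nonzero linear
form which is a monomial is a multiple of one variable). [folklore] -/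
theorem exists_single_of_linearForm_dvd_monomial {α : ι → K} {s : ι →₀ ℕ} {a : K} (ha : a ≠ 0)
    (hdvd : (∑ c, α c • (X c : MvPolynomial ι K)) ∣ monomial s a) :
    ∃ c₀, α c₀ ≠ 0 ∧ ∀ c, c ≠ c₀ → α c = 0 := by
  obtain ⟨m, b, -, -, hL⟩ := (dvd_monomial_iff_exists ha).mp hdvd
  have hb : b ≠ 0 := by
    rintro rfl
    rw [monomial_zero] at hL
    rw [hL] at hdvd
    exact (monomial_eq_zero.not.mpr ha) (zero_dvd_iff.mp hdvd)
  have hcm : coeff m (∑ c, α c • (X c : MvPolynomial ι K)) = b := by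
    rw [hL, coeff_monomial, if_pos rfl]
  have hex : ∃ c₀, Finsupp.single c₀ 1 = m := by
    by_contra hne
    apply hb
    rw [← hcm]
    simp only [coeff_sum, coeff_smul, coeff_X, smul_eq_mul]
    exact sum_eq_zero fun c _ => by rw [if_neg (fun h => hne ⟨c, h⟩), mul_zero]
  obtain ⟨c₀, rfl⟩ := hex
  refine ⟨c₀, ?_, fun c hc => ?_⟩
  · rw [← coeff_single_linearForm α c₀, hcm]
    exact hb
  · rw [← coeff_single_linearForm α c, hL, coeff_monomial, if_neg]
    exact fun h => hc (Finsupp.single_left_injective one_ne_zero h).symm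

end LinearForm

section PermGraph

variable {K : Type*} [CommRing K] {N : ℕ}

/-- The permanent of the `0/1` matrix of the graph of a bijection `i ↦ j` (`σ⁻¹ i = π⁻¹ j`) is `1`
(a row- and column-permuted identity matrix). [folklore] -/
theorem permanent_of_perm_graph (σ π : Equiv.Perm (Fin N)) :
    (Matrix.of fun i j : Fin N => if σ.symm i = π.symm j then (1 : K) else 0).permanent = 1 := by
  have h : (Matrix.of fun i j : Fin N => if σ.symm i = π.symm j then (1 : K) else 0) =
      (((1 : Matrix (Fin N) (Fin N) K).submatrix σ.symm id).submatrix id π.symm) := by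
    ext i j
    simp [Matrix.one_apply]
  rw [h, Matrix.permanent_permute_rows, Matrix.permanent_permute_cols, Matrix.permanent_one]

end PermGraph

section Rigidity

variable {K : Type*} [Field K] [CharZero K] {N : ℕ}

/-- **Rigidity of weighted permanents** (one-sided Marcus–May, polynomial-identity form). Let
`w : 𝔖_N → K` be path weights and `α t c` the coefficients of one linear form per level `t`. If
`∑_σ w(σ) • ∏ₜ (∑_c α t c • x_{σ t, c}) = per_N(x)` in `K[x_{kc}]` (`char K = 0`), then `α` is a
monomial matrix — `α t c = d t · [c = π t]` for a permutation `π` and scalars `d t` — and every path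
weight satisfies `w(σ) · ∏ₜ d t = 1` (in particular all `w(σ)` are equal and nonzero). [folklore] -/
theorem exists_monomial_of_weighted_permanent_eq_perPoly (w : Equiv.Perm (Fin N) → K)
    (α : Fin N → Fin N → K)
    (h : ∑ σ : Equiv.Perm (Fin N),
        w σ • ∏ t, ∑ c, α t c • (X (σ t, c) : MvPolynomial (Fin N × Fin N) K) =
      perPoly (Fin N) K) :
    ∃ (π : Equiv.Perm (Fin N)) (d : Fin N → K),
      (∀ t c, α t c = if c = π t then d t else 0) ∧ ∀ σ, w σ * ∏ t, d t = 1 := by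
  classical
  -- Step 1: all rows equal, `x_{k,c} ↦ v_c`
  let φ : MvPolynomial (Fin N × Fin N) K →ₐ[K] MvPolynomial (Fin N) K := aeval fun p => X p.2
  have hφX : ∀ p : Fin N × Fin N, φ (X p) = X p.2 := fun p => aeval_X _ p
  let s : Fin N →₀ ℕ := ∑ c : Fin N, Finsupp.single c 1
  have hprodX : ∏ c : Fin N, (X c : MvPolynomial (Fin N) K) = monomial s 1 := by
    rw [monomial_sum_one]
    rfl
  have hfac : ((N.factorial : ℕ) : K) ≠ 0 := Nat.cast_ne_zero.mpr (Nat.factorial_ne_zero N)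
  have hE : (∑ σ : Equiv.Perm (Fin N), w σ) • ∏ t, ∑ c, α t c • (X c : MvPolynomial (Fin N) K) =
      monomial s (N.factorial : K) := by
    have h1 := congrArg φ h
    simp only [map_sum, map_smul, map_prod, hφX] at h1
    rw [← Finset.sum_smul] at h1
    rw [h1]
    simp only [perPoly, Matrix.permanent, Matrix.mvPolynomialX_apply, map_sum, map_prod, hφX]
    rw [Finset.sum_const, Finset.card_univ, Fintype.card_perm, Fintype.card_fin, hprodX,
      ← Nat.cast_smul_eq_nsmul K, smul_monomial, smul_eq_mul, mul_one]
  set W : K := ∑ σ : Equiv.Perm (Fin N), w σ with hW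
  have hW0 : W ≠ 0 := by
    intro h0
    rw [h0, zero_smul] at hE
    exact (monomial_eq_zero.not.mpr hfac) hE.symm
  have hprodL :
      ∏ t, ∑ c, α t c • (X c : MvPolynomial (Fin N) K) = monomial s (W⁻¹ * N.factorial) := by
    have h1 := congrArg (fun p => W⁻¹ • p) hE
    simp only [smul_smul, inv_mul_cancel₀ hW0, one_smul, smul_monomial, smul_eq_mul] at h1
    exact h1
  have hWN : W⁻¹ * (N.factorial : K) ≠ 0 := mul_ne_zero (inv_ne_zero hW0) hfac
  -- Step 2: every level form is a multiple of one variable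
  have hrow : ∀ t, ∃ c₀, α t c₀ ≠ 0 ∧ ∀ c, c ≠ c₀ → α t c = 0 := fun t =>
    exists_single_of_linearForm_dvd_monomial hWN
      (hprodL ▸ dvd_prod_of_mem (fun t => ∑ c, α t c • (X c : MvPolynomial (Fin N) K)) (mem_univ t))
  choose f hf0 hf using hrow
  have hLt : ∀ t, ∑ c, α t c • (X c : MvPolynomial (Fin N) K) = α t (f t) • X (f t) := fun t =>
    sum_eq_single (f t) (fun c _ hc => by rw [hf t c hc, zero_smul])
      (fun h => absurd (mem_univ _) h)
  -- Step 3: `f` is a bijection (compare exponent vectors)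
  have hsf : (∑ t, Finsupp.single (f t) 1 : Fin N →₀ ℕ) = s := by
    have h1 : ∏ t, ∑ c, α t c • (X c : MvPolynomial (Fin N) K) =
        monomial (∑ t, Finsupp.single (f t) 1) (∏ t, α t (f t)) := by
      simp_rw [hLt, smul_eq_C_mul]
      rw [prod_mul_distrib, ← map_prod,
        show (∏ x, (X (f x) : MvPolynomial (Fin N) K)) =
          ∏ x, monomial (Finsupp.single (f x) 1) (1 : K) from rfl,
        ← monomial_sum_one, C_mul_monomial, mul_one]
    rw [hprodL, monomial_eq_monomial_iff] at h1
    rcases h1 with ⟨h1, -⟩ | ⟨h1, -⟩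
    · exact h1.symm
    · exact absurd h1 hWN
  have hinj : Function.Injective f := by
    rw [Finite.injective_iff_surjective]
    by_contra hsurj
    obtain ⟨c₁, hc₁⟩ : ∃ c₁, ∀ t, f t ≠ c₁ := by simpa [Function.Surjective] using hsurj
    have h1 := congrArg (fun v : Fin N →₀ ℕ => v c₁) hsf
    simp [s, Finsupp.finsetSum_apply, Finsupp.single_apply, hc₁] at h1
  set π : Equiv.Perm (Fin N) := Equiv.ofBijective f (Finite.injective_iff_bijective.mp hinj)
    with hπ_def
  have hπ : ∀ t, π t = f t := fun t => rfl
  refine ⟨π, fun t => α t (f t), fun t c => ?_, fun σ₀ => ?_⟩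
  · rw [hπ]
    by_cases hc : c = f t
    · rw [if_pos hc, hc]
    · rw [if_neg hc, hf t c hc]
  · -- Step 4: evaluate at the permutation matrix of `σ₀ π⁻¹`
    let x₀ : Fin N × Fin N → K := fun p => if σ₀.symm p.1 = π.symm p.2 then 1 else 0
    have hev := congrArg (eval x₀) h
    rw [eval_perPoly] at hev
    have hR : (Matrix.of fun i j : Fin N => x₀ (i, j)).permanent = 1 := permanent_of_perm_graph σ₀ π
    rw [hR] at hev
    rw [← hev]
    simp only [map_sum, smul_eval, map_prod, eval_X]
    have hinner : ∀ (σ : Equiv.Perm (Fin N)) (t : Fin N),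
        ∑ c, α t c * x₀ (σ t, c) = α t (f t) * if σ₀.symm (σ t) = t then 1 else 0 := by
      intro σ t
      rw [Finset.sum_eq_single (f t) (fun c _ hc => by rw [hf t c hc, zero_mul])
        (fun h' => absurd (mem_univ _) h')]
      simp only [x₀]
      rw [show π.symm (f t) = t from π.symm_apply_eq.mpr (hπ t).symm]
    simp_rw [hinner]
    rw [Finset.sum_eq_single σ₀ ?_ (fun h' => absurd (mem_univ _) h')]
    · simp
    · intro σ _ hσ
      obtain ⟨t, ht⟩ : ∃ t, σ t ≠ σ₀ t := by
        by_contra hall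
        exact hσ (Equiv.ext fun t => by simpa using not_exists.mp hall t)
      rw [prod_eq_zero (mem_univ t), mul_zero]
      rw [if_neg (fun h' => ht (σ₀.symm_apply_eq.mp h')), mul_zero]

end Rigidity

end Literature.Computability.AlgebraicComplexity
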